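import Summits.HubbardSuperconductivity.HubbardSuperconductivity.Theorems.LevyLogBootstrapBlock2InfDivXXZAutSymmetry
import Literature.Probability.LatticeModels.TorusFourHypercube
import HarnessLib

/-!
# Crux `Block2InfDivXXZ` (stmt-HubbardSuperconductivity-15048, route `LevyLogBootstrap`):
# the hidden hypercube symmetry of the `4 × 4` torus — sector ground-state kernels are RADIAL

Support file for the `M = 4` slice of the crux. The `4 × 4` torus graph is the `4`-cube `Q₄`
(`Literature.Probability.LatticeModels.TorusFour.adj_iff_hammingDist_eq_one`), so its automorphism
group (order `384`) is three times the group generated by translations, the coordinate swap and the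
inversions (order `128`) that the route's files have used so far (`…KernelCovariance`,
`…AutSymmetry`). By Perron–Frobenius uniqueness in each magnetisation sector
(`sectorGS_transverseCorr_comp`, `…AutSymmetry.lean`) every graph automorphism fixes the transverse
kernel of a sector ground vector, for EVERY real `Δ`:

* `sectorGS_transverseCorr_hypercubeAut` — `⟨ψ, S⁺_{τx} S⁻_{τy} ψ⟩ = ⟨ψ, S⁺_x S⁻_y ψ⟩` for the bit
  permutations `τ = TorusFour.hypercubeAut s`;
* `sectorGS_transverseKernel_radial` — **radiality**: `⟨ψ, S⁺_x S⁻_0 ψ⟩` depends only on the Gray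
  weight of `x` (its graph distance from `0`): it equals the value at the representative
  `0, (1,0), (1,1), (2,1), (2,2)` of the weight `0,…,4`; so the `4 × 4` kernel has FIVE values
  `κ₀ = ½, κ₁, κ₂, κ₃, κ₄`, not six;
* `sectorGS_transverseKernel_hypercube_four` (registered sub-goal) — the one identity beyond `D₄`:
  `⟨ψ, S⁺_{(1,1)} S⁻_0 ψ⟩ = ⟨ψ, S⁺_{(2,0)} S⁻_0 ψ⟩`.

Uses: (i) the `M = 4` feasibility programme of `EVIDENCE-RP-K1-smallM-v3.md` (item evidence), where
the `D₄`-only constraint set admits a violator of the corner Lévy coefficient at `Δ = 0` and the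
`Aut(Q₄)`-symmetric one does not; (ii) any exact/certified computation on the `4 × 4` torus: with the
global spin flip the symmetric subspace of the half-filled sector has dimension `58` (Burnside)
instead of `107`. Tasaki, *Physics and Mathematics of Quantum Many-Body Systems* (2020) §2.1;
Brouwer–Haemers, *Spectra of Graphs* (2012) §12.4.1. No definition is introduced; sorry-free.
-/

noncomputable section

set_option linter.dupNamespace false

namespace Summit.HubbardSuperconductivity.HubbardSuperconductivity.Theorems.LevyLogBootstrap

open scoped BigOperators Matrix ComplexOrder
open Matrix Finset Complex
open Literature.MathematicalPhysics.QuantumLattice Literature.Probability.LatticeModels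
open Literature.Probability.LatticeModels.TorusFour
open Summit.AtomisticToContinuum.BoseEinsteinCondensation.Theorems.BECStronglyRayleighSectorPerron
  (torusGraph_connected)

/-- **Hypercube automorphisms fix the transverse kernel of every sector ground vector** of
`H₄(Δ) = xxzHamiltonian 1 (torusGraph 2 4) (-1) Δ`, any real `Δ`, any sector value `m`:
`⟨ψ, S⁺_{τ x} S⁻_{τ y} ψ⟩ = ⟨ψ, S⁺_x S⁻_y ψ⟩` for `τ = hypercubeAut s`, `s` any permutation of the
four Gray bits (`sectorGS_transverseCorr_comp` + `TorusFour.hypercubeAut_adj`). Tasaki (2020) §2.1.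
[folklore] -/
theorem sectorGS_transverseCorr_hypercubeAut (Δ m : ℝ) (s : Equiv.Perm (Fin 4))
    (ψ : TensorIndex (TorusSite 2 4) 2 → ℂ) (hψ : ψ ∈ spinZSector (Λ := TorusSite 2 4) 1 m)
    (hH : xxzHamiltonian 1 (torusGraph 2 4) (-1) Δ *ᵥ ψ =
      ((lowestEnergyInSector 1 (xxzHamiltonian 1 (torusGraph 2 4) (-1) Δ) m : ℝ) : ℂ) • ψ)
    (x y : TorusSite 2 4) :
    star ψ ⬝ᵥ ((onSite (hypercubeAut s x) (spinRaise 1) * onSite (hypercubeAut s y) (spinLower 1)) *ᵥ ψ) =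
      star ψ ⬝ᵥ ((onSite x (spinRaise 1) * onSite y (spinLower 1)) *ᵥ ψ) :=
  sectorGS_transverseCorr_comp (torusGraph 2 4) (torusGraph_connected 2 4) Δ m (hypercubeAut s)
    (fun a b => hypercubeAut_adj s a b) ψ hψ hH x y

/-- **Radiality of the transverse kernel on the `4 × 4` torus**: for every real `Δ`, sector value
`m` and sector ground vector `ψ` of `H₄(Δ)`, `⟨ψ, S⁺_x S⁻_0 ψ⟩` equals its value at the
representative `TorusFour.weightRep (TorusFour.grayWeight x) ∈ {0, (1,0), (1,1), (2,1), (2,2)}` of the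
Gray weight (`=` graph distance from `0`) of `x` — the stabiliser of `0` in `Aut(Q₄) ≅ 2⁴·S₄` is
transitive on spheres (`TorusFour.hypercubeAut_permFor`, `TorusFour.hypercubeAut_zero`).
Brouwer–Haemers (2012) §12.4.1; Tasaki (2020) §2.1. [folklore] -/
theorem sectorGS_transverseKernel_radial (Δ m : ℝ)
    (ψ : TensorIndex (TorusSite 2 4) 2 → ℂ) (hψ : ψ ∈ spinZSector (Λ := TorusSite 2 4) 1 m)
    (hH : xxzHamiltonian 1 (torusGraph 2 4) (-1) Δ *ᵥ ψ =
      ((lowestEnergyInSector 1 (xxzHamiltonian 1 (torusGraph 2 4) (-1) Δ) m : ℝ) : ℂ) • ψ)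
    (x : TorusSite 2 4) :
    star ψ ⬝ᵥ ((onSite x (spinRaise 1) * onSite 0 (spinLower 1)) *ᵥ ψ) =
      star ψ ⬝ᵥ ((onSite (weightRep (grayWeight x)) (spinRaise 1) * onSite 0 (spinLower 1)) *ᵥ ψ) := by
  have h := sectorGS_transverseCorr_hypercubeAut Δ m (permFor x) ψ hψ hH (weightRep (grayWeight x)) 0
  rw [hypercubeAut_permFor, hypercubeAut_zero] at h
  exact h

set_option linter.style.longLine false in
/-- **Registered sub-goal `sectorGS_transverseKernel_hypercube_four`** (crux `Block2InfDivXXZ`,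
`M = 4` slice): the hidden-hypercube identity `⟨ψ, S⁺_{(1,1)} S⁻_0 ψ⟩ = ⟨ψ, S⁺_{(2,0)} S⁻_0 ψ⟩` for
every real `Δ`, sector value `m` and sector ground vector `ψ` of `xxzHamiltonian 1 (torusGraph 2 4) (-1) Δ`
(both sites have Gray weight `2`; the bit transposition `(b₀ b₃)` exchanges them and fixes `0`). Not a
consequence of the translation/`D₄` symmetry used elsewhere in the route. [folklore] -/
theorem sectorGS_transverseKernel_hypercube_four :
    ∀ (Δ m : ℝ) (ψ : TensorIndex (TorusSite 2 4) 2 → ℂ), ψ ∈ @spinZSector (TorusSite 2 4) _ _ 1 m →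
      Matrix.mulVec (xxzHamiltonian 1 (torusGraph 2 4) (-1) Δ) ψ =
        ((lowestEnergyInSector 1 (xxzHamiltonian 1 (torusGraph 2 4) (-1) Δ) m : ℝ) : ℂ) • ψ →
      star ψ ⬝ᵥ Matrix.mulVec (onSite (![1, 1] : TorusSite 2 4) (spinRaise 1) * onSite 0 (spinLower 1)) ψ =
        star ψ ⬝ᵥ Matrix.mulVec (onSite (![2, 0] : TorusSite 2 4) (spinRaise 1) * onSite 0 (spinLower 1)) ψ := by
  intro Δ m ψ hψ hH
  have h1 := sectorGS_transverseKernel_radial Δ m ψ hψ hH ![1, 1]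
  have h2 := sectorGS_transverseKernel_radial Δ m ψ hψ hH ![2, 0]
  have e1 : weightRep (grayWeight ![1, 1]) = ![1, 1] := by decide
  have e2 : weightRep (grayWeight ![2, 0]) = ![1, 1] := by decide
  rw [e2] at h2
  rw [h2]

end Summit.HubbardSuperconductivity.HubbardSuperconductivity.Theorems.LevyLogBootstrap
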